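import Literature.Algebra.Homology.ExactCoupleLefschetz
import Literature.Geometry.Kaehler.LefschetzOperator
import Literature.AlgebraicTopology.SingularHomology.UniversalCoefficientsField
import Mathlib.LinearAlgebra.Dual.Lemmas
import HarnessLib

/-!
# Hard Lefschetz in cap-product form from the cohomological hard Lefschetz property

Topic `Literature/AlgebraicTopology/SingularHomology`. The tree states hard Lefschetz
cohomologically (`Literature.Geometry.Kaehler.HasHardLefschetzProperty κ n`: the iterated cup
product `Lⁱ = (κ ⌣ ·)ⁱ : H^{lo}(X; K) → H^{lo+2i}(X; K)` is bijective for `lo + i = n`; C. Voisin,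
*Hodge Theory and Complex Algebraic Geometry I* (2002), Thm. 6.25), while its Deligne-degeneration
programme (`FiltrationCapEndo`, `ExactCoupleLefschetz.EHardLefschetz`, `SerreFibrationCellCap`)
runs on HOMOLOGY with CAP products. This file provides the bridge, for any space and any field:

* `kroneckerPairing_lefschetzPow` — the adjunction `⟨Lⁱ a, x⟩ = ⟨a, (κ ⌢ ·)ⁱ x⟩` (iterating
  Hatcher's `⟨a ⌣ b, x⟩ = ⟨b, a ⌢ x⟩`, §3.3 p. 241), with `(κ ⌢ ·)ⁱ` the tree's `iterDown` of the
  cap product (the shape used by `EHardLefschetz`);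
* `bijective_iterDown_capProduct_of_hasHardLefschetzProperty` — **if `Lⁱ : H^{lo} ≅ H^{lo+2i}` (`lo + i = n`)
  then `(κ ⌢ ·)ⁱ : H_{lo+2i}(X; K) ≅ H_{lo}(X; K)`**: under the Kronecker isomorphisms
  `H^q ≅ Hom(H_q, K)` (universal coefficients over a field, Hatcher Thm. 3.2 / p. 198) `Lⁱ` is the
  transpose of `(κ ⌢ ·)ⁱ`, and a linear map of vector spaces is injective (surjective) iff its
  transpose is surjective (injective). No finiteness is needed.

This is the fibrewise input "hard Lefschetz on `H_•(F)` under `η|_F ⌢`" of `EHardLefschetz` on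
the `E¹`-term of the skeletal filtration of a projective family (Voisin II, proof of Thm. 4.15),
e.g. for `Literature.AlgebraicGeometry.HodgeTheory.Arapura2022_thm_1_2_smoothPart_pgZeroSurfaceFibration`
(surface fibres, `n = 2`) and for the invariant cycle theorem. Everything is proved; no definition and no named fact is introduced (D-0026).

## References

* C. Voisin, *Hodge Theory and Complex Algebraic Geometry I*, CUP (2002), §6.2.3, Thm. 6.25.
  [VoisinHodgeI2002]
* C. Voisin, *Hodge Theory and Complex Algebraic Geometry II*, CUP (2003), Thm. 4.15 (proof).
  [VoisinHodgeII2003]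
* A. Hatcher, *Algebraic Topology*, CUP (2002), §3.1 Thm. 3.2 and p. 198; §3.3 p. 241.
  [HatcherAT2002]
-/

noncomputable section

open Function Literature.Algebra.Homology Literature.Geometry.Kaehler

namespace Literature.AlgebraicTopology.SingularHomology

universe u v

variable (K : Type v) [Field K] {X : Type u} [TopologicalSpace X] (κ : singularCohomology K K X 2)

/-- **Adjunction `⟨Lⁱ a, x⟩ = ⟨a, (κ ⌢ ·)ⁱ x⟩`** between the iterated Lefschetz operator (cup with
`κ` on the left, `lefschetzPow`) and the iterated cap product, by induction from
`⟨a ⌣ b, x⟩ = ⟨b, a ⌢ x⟩`. [cite: HatcherAT2002, §3.3 p. 241] -/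
theorem kroneckerPairing_lefschetzPow (i lo : ℕ) (a : singularCohomology K K X lo)
    (x : singularHomology K K X (lo + 2 * i)) :
    kroneckerPairing K K X (lo + 2 * i) (lefschetzPow κ i lo a) x =
      kroneckerPairing K K X lo a (iterDown (V := fun q => singularHomology K K X q)
        (fun m => capProduct (show 2 + m = m + 2 by omega) κ) i lo x) := by
  induction i with
  | zero => rfl
  | succ i ih =>
    rw [lefschetzPow_succ, LinearMap.comp_apply, lefschetzOperator_apply]
    change kroneckerPairing K K X (lo + 2 * i + 2) (cupProduct _ κ (lefschetzPow κ i lo a)) x = _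
    rw [kroneckerPairing_cupProduct, ih]
    rfl

/-- **Hard Lefschetz in cap-product form from the cohomological hard Lefschetz property** (any
space, any field): if `Lⁱ = (κ ⌣ ·)ⁱ : H^{lo}(X; K) → H^{lo+2i}(X; K)` is bijective for
`lo + i = n` (`HasHardLefschetzProperty κ n`, Voisin I Thm. 6.25 for a Kähler class), then
`(κ ⌢ ·)ⁱ : H_{lo+2i}(X; K) → H_{lo}(X; K)` is bijective — `Lⁱ` is the transpose of `(κ ⌢ ·)ⁱ`
under the Kronecker isomorphisms `H^q ≅ Hom(H_q, K)`, and a linear map of vector spaces is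
injective, resp. surjective, iff its transpose is surjective, resp. injective.
[cite: VoisinHodgeI2002, Thm. 6.25] [cite: HatcherAT2002, §3.1 Thm. 3.2 (p. 198) and §3.3 p. 241] -/
theorem bijective_iterDown_capProduct_of_hasHardLefschetzProperty {n : ℕ}
    (hHL : HasHardLefschetzProperty κ n) {i lo : ℕ} (h : lo + i = n) :
    Bijective (iterDown (V := fun q => singularHomology K K X q)
      (fun m => capProduct (show 2 + m = m + 2 by omega) κ) i lo) := by
  set T := iterDown (V := fun q => singularHomology K K X q)
      (fun m => capProduct (show 2 + m = m + 2 by omega) κ) i lo with hT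
  -- `κ_{lo+2i} ∘ Lⁱ = T^* ∘ κ_{lo}` for the Kronecker maps `κ_q : H^q → Hom(H_q, K)`
  have hadj : kroneckerPairing K K X (lo + 2 * i) ∘ₗ lefschetzPow κ i lo =
      T.dualMap ∘ₗ kroneckerPairing K K X lo := by
    refine LinearMap.ext fun a => LinearMap.ext fun x => ?_
    exact kroneckerPairing_lefschetzPow K κ i lo a x
  have hS : Bijective (lefschetzPow κ i lo) := hHL i lo h
  have hdual : Bijective T.dualMap := by
    have h1 : Bijective (kroneckerPairing K K X (lo + 2 * i) ∘ₗ lefschetzPow κ i lo) :=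
      (kroneckerPairing_bijective_of_field K X (lo + 2 * i)).comp hS
    rw [hadj] at h1
    exact (Bijective.of_comp_iff _ (kroneckerPairing_bijective_of_field K X lo)).1 h1
  exact ⟨(LinearMap.dualMap_surjective_iff).1 hdual.2, (LinearMap.dualMap_injective_iff).1 hdual.1⟩

end Literature.AlgebraicTopology.SingularHomology

end
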